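import Mathlib
import HarnessLib
import Summits.NavierStokesRegularity.NavierStokesRegularity.Theorems.PoloidalWindowDoorLrcModEntireTwistingTHGradientLiouville
import Summits.NavierStokesRegularity.NavierStokesRegularity.Theorems.PoloidalWindowDoorLrcModEntireTwistingTHMassiveLiouville

/-!
# Item `LrcModEntire` (stmt-NavierStokesRegularity-20428), skeleton twist_split v6 — cell T1 step (I), the ENDGAME of the jet analysis:
# **the «bad data» produced by a non-flat slice over a flat thread plane cannot exist** (modulo the one-signed Helmholtz Liouville theorem (L3))

Cell ns-regularity-ideate, LEAD ns-poloidal-K2-p3 g13 (`--supports stmt-NavierStokesRegularity-20428`; CELLS-TH-g13 §2ter).  The z-jet analysis at a flat thread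
plane (steps (Z)(S)(P)(T) of the Lean plan — NOT in this file) produces a potential `Φ ∈ C³(ℝ³)` (the `x₂`-independent extension of the first non-constant jet
potential `φ_{j₀}`) with BOUNDED gradient, SIGNED Laplacian `ΔΦ ≥ 0` (the sign pin `b_{k₀} ≤ 0`, `b_{k₀} = −ΔΦ`), `ΔΦ ≢ 0`, and the LEADING-ORDER (TH) DICHOTOMY:
either `∇(ΔΦ)` is a constant covector, or `∇Φ = −μ₀ ∇(ΔΦ)` for a constant `μ₀`.  This file kills such data:

* `affine_of_fderiv_const` — constant derivative ⇒ affine;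
* `noBadData` — **no `Φ` as above exists**, given (L3) «`ψ ∈ C²(ℝ³)`, `ψ ≤ 0`, `Δψ = −κψ` with `κ > 0` ⇒ `ψ ≡ 0`» as a hypothesis: branch «`∇ΔΦ` constant» ⇒
  `ΔΦ` affine and signed ⇒ constant ⇒ `0` by (L1) `…GradientLiouville.gradientLiouville`; branch «`∇Φ = −μ₀∇ΔΦ`»: `μ₀ = 0` ⇒ `∇Φ = 0` ⇒ `ΔΦ = 0`; `μ₀ < 0` ⇒
  `ψ = Φ − κ₀` solves `Δψ = (−1/μ₀)ψ` ⇒ (L2) `…MassiveLiouville.massiveLiouville` ⇒ `ΔΦ ≡ 0`; `μ₀ > 0` ⇒ `Δψ + ψ/μ₀ = 0` with `ψ = −μ₀ΔΦ ≤ 0` ⇒ (L3) ⇒ `ΔΦ ≡ 0`.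

WHAT THIS IS NOT: not a claim about Navier–Stokes regularity; (L3) is taken as a hypothesis; T1 stays OPEN (bears_on LADDER-NS N0, item 20428 / crux 19708).
-/

noncomputable section

-- the summit and its single sub-problem share the name (CONVENTIONS §1), as in every Theorems file
set_option linter.dupNamespace false

namespace Summit.NavierStokesRegularity.NavierStokesRegularity.Theorems.PoloidalWindowDoorLrcModEntireTwistingTHBadDataNoGo

open Set Function Filter Topology InnerProductSpace
open scoped RealInnerProductSpace InnerProductSpace Laplacian ContDiff
open Summit.NavierStokesRegularity.NavierStokesRegularity.Theorems.PoloidalWindowDoorLrcModEntireTwistingTHGradientLiouville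
open Summit.NavierStokesRegularity.NavierStokesRegularity.Theorems.PoloidalWindowDoorLrcModEntireTwistingTHMassiveLiouville

/-- A differentiable function with constant derivative `L` is affine: `f x = f 0 + L x`. -/
theorem affine_of_fderiv_const {f : EuclideanSpace ℝ (Fin 3) → ℝ} (hf : Differentiable ℝ f) {L : EuclideanSpace ℝ (Fin 3) →L[ℝ] ℝ}
    (hL : ∀ x, fderiv ℝ f x = L) (x : EuclideanSpace ℝ (Fin 3)) : f x = f 0 + L x := by
  have hg : ∀ y, HasFDerivAt (fun y : EuclideanSpace ℝ (Fin 3) => f 0 + L y) L y := fun y =>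
    (L.hasFDerivAt).const_add (f 0)
  have h := Convex.eqOn_of_fderivWithin_eq (𝕜 := ℝ) (f := f) (g := fun y => f 0 + L y) convex_univ
    (fun y _ => (hf y).differentiableWithinAt) (fun y _ => (hg y).differentiableAt.differentiableWithinAt) isOpen_univ.uniqueDiffOn
    (fun y _ => by rw [fderivWithin_univ, fderivWithin_univ, hL y, (hg y).fderiv]) (mem_univ 0) (by simp) (mem_univ x)
  exact h

/-- **NO BAD DATA (modulo (L3)).**  There is no `Φ ∈ C³(ℝ³)` with bounded gradient, `ΔΦ ≥ 0`, `ΔΦ ≢ 0`, and [`∇(ΔΦ)` constant OR `∇Φ = −μ₀∇(ΔΦ)`] —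
provided one-signed entire solutions of `Δψ + κψ = 0` (`κ > 0`) vanish (hypothesis `hL3`). -/
theorem noBadData
    (hL3 : ∀ (ψ : EuclideanSpace ℝ (Fin 3) → ℝ) (κ : ℝ), ContDiff ℝ 2 ψ → 0 < κ → (∀ x, ψ x ≤ 0) → (∀ x, (Δ ψ) x = -κ * ψ x) → ∀ x, ψ x = 0)
    {Φ : EuclideanSpace ℝ (Fin 3) → ℝ} (hΦ : ContDiff ℝ 3 Φ) {G : ℝ} (hG : ∀ x, ‖fderiv ℝ Φ x‖ ≤ G)
    (hsign : ∀ x, 0 ≤ (Δ Φ) x) (hne : ∃ x, (Δ Φ) x ≠ 0)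
    (hdich : (∃ L : EuclideanSpace ℝ (Fin 3) →L[ℝ] ℝ, ∀ x, fderiv ℝ (Δ Φ) x = L) ∨
      (∃ μ₀ : ℝ, ∀ x, fderiv ℝ Φ x = (-μ₀) • fderiv ℝ (Δ Φ) x)) : False := by
  obtain ⟨x₁, hx₁⟩ := hne
  -- `ΔΦ` is `C¹`
  have hΔc : ContDiff ℝ 1 (Δ Φ) := by
    have h1 : ContDiff ℝ 2 (fderiv ℝ Φ) := hΦ.fderiv_right (m := 2) (by norm_cast)
    have h2 : ContDiff ℝ 1 (fderiv ℝ (fderiv ℝ Φ)) := h1.fderiv_right (m := 1) (by norm_cast)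
    have e : Δ Φ = fun y => ∑ i : Fin 3, fderiv ℝ (fderiv ℝ Φ) y (EuclideanSpace.basisFun (Fin 3) ℝ i)
        (EuclideanSpace.basisFun (Fin 3) ℝ i) := by
      rw [InnerProductSpace.laplacian_eq_iteratedFDeriv_orthonormalBasis Φ (EuclideanSpace.basisFun (Fin 3) ℝ)]
      funext y
      refine Finset.sum_congr rfl fun i _ => ?_
      rw [iteratedFDeriv_two_apply]
      rfl
    rw [e]
    exact ContDiff.sum fun i _ => (h2.clm_apply contDiff_const).clm_apply contDiff_const
  have hΔd : Differentiable ℝ (Δ Φ) := hΔc.differentiable one_ne_zero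
  have hΦd : Differentiable ℝ Φ := hΦ.differentiable (by simp)
  rcases hdich with ⟨L, hL⟩ | ⟨μ₀, hμ⟩
  · -- branch 1: `ΔΦ` affine and non-negative ⇒ `L = 0` ⇒ `ΔΦ ≡ β` ⇒ (L1) ⇒ `β = 0`
    have haff : ∀ x, (Δ Φ) x = (Δ Φ) 0 + L x := affine_of_fderiv_const hΔd hL
    have hL0 : L = 0 := by
      by_contra hL0
      obtain ⟨u, hu⟩ : ∃ u, L u ≠ 0 := by
        by_contra h; push Not at h; exact hL0 (ContinuousLinearMap.ext fun u => by simpa using h u)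
      -- along the line `t u` the affine function `ΔΦ(0) + t L u` becomes negative
      set t : ℝ := -((Δ Φ) 0 + 1) / L u with ht
      have h1 := hsign (t • u)
      rw [haff, map_smul, smul_eq_mul] at h1
      have e : t * L u = -((Δ Φ) 0 + 1) := by rw [ht]; field_simp
      linarith
    have hβ : ∀ x, (Δ Φ) x = (Δ Φ) 0 := fun x => by rw [haff x, hL0]; simp
    have h0 := (gradientLiouville hΦ hβ hG).1
    exact hx₁ (by rw [hβ x₁, h0])
  · rcases lt_trichotomy μ₀ 0 with hneg | hzero | hpos
    · -- branch 2, `μ₀ < 0`: `ψ = Φ − κ₀` solves `Δψ = (−1/μ₀) ψ` ⇒ (L2)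
      have hconst : ∀ x, Φ x + μ₀ * (Δ Φ) x = Φ 0 + μ₀ * (Δ Φ) 0 := by
        intro x
        have hd : Differentiable ℝ (fun y => Φ y + μ₀ * (Δ Φ) y) := hΦd.add (hΔd.const_mul μ₀)
        refine is_const_of_fderiv_eq_zero hd (fun y => ?_) x 0
        have hy : HasFDerivAt (fun y => Φ y + μ₀ * (Δ Φ) y) (fderiv ℝ Φ y + μ₀ • fderiv ℝ (Δ Φ) y) y :=
          (hΦd y).hasFDerivAt.add ((hΔd y).hasFDerivAt.const_mul μ₀)
        rw [hy.fderiv, hμ y]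
        simp
      set κ₀ : ℝ := Φ 0 + μ₀ * (Δ Φ) 0 with hκ₀
      set ψ : EuclideanSpace ℝ (Fin 3) → ℝ := fun y => Φ y - κ₀ with hψ
      have hψc : ContDiff ℝ 2 ψ := (hΦ.of_le (by norm_cast)).sub contDiff_const
      have hψG : ∀ x, ‖fderiv ℝ ψ x‖ ≤ G := fun x => by
        rw [hψ, fderiv_sub_const]; exact hG x
      have hΔψ : ∀ x, (Δ ψ) x = (Δ Φ) x := fun x => by
        rw [hψ, show (fun y => Φ y - κ₀) = Φ - fun _ => κ₀ from rfl]
        have hΦ2 : ContDiff ℝ 2 Φ := hΦ.of_le (by norm_cast)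
        rw [hΦ2.contDiffAt.laplacian_sub (contDiff_const (c := κ₀)).contDiffAt]
        simp
      have heq : ∀ x, (Δ ψ) x = (-1 / μ₀) * ψ x := fun x => by
        rw [hΔψ x, hψ]
        have h := hconst x
        have hμ0 : μ₀ ≠ 0 := hneg.ne
        show (Δ Φ) x = (-1 / μ₀) * (Φ x - κ₀)
        have h2 : μ₀ * (Δ Φ) x = κ₀ - Φ x := by linarith
        have h3 : (Δ Φ) x = (κ₀ - Φ x) / μ₀ := by
          rw [← h2]; field_simp
        rw [h3]; ring
      have hzero := massiveLiouville hψc (by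
        have : 0 < -μ₀ := neg_pos.2 hneg
        have e : -1 / μ₀ = 1 / (-μ₀) := by field_simp
        rw [e]; positivity) hψG heq
      have : (Δ Φ) x₁ = 0 := by
        rw [← hΔψ x₁, heq x₁, hzero x₁, mul_zero]
      exact hx₁ this
    · -- `μ₀ = 0`: `∇Φ = 0` ⇒ `Φ` constant ⇒ `ΔΦ = 0`
      subst hzero
      have hβ : ∀ x, (Δ Φ) x = (Δ Φ) x := fun _ => rfl
      have hgrad : ∀ x, fderiv ℝ Φ x = 0 := fun x => by rw [hμ x]; simp
      have hΦconst : ∀ x, Φ x = Φ 0 := fun x => is_const_of_fderiv_eq_zero hΦd hgrad x 0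
      have hΦfun : Φ = fun _ => Φ 0 := funext hΦconst
      have : (Δ Φ) x₁ = 0 := by rw [hΦfun]; simp
      exact hx₁ this
    · -- branch 2, `μ₀ > 0`: `ψ = −μ₀ ΔΦ = Φ − κ₀ ≤ 0` solves `Δψ = −(1/μ₀) ψ` ⇒ (L3)
      have hconst : ∀ x, Φ x + μ₀ * (Δ Φ) x = Φ 0 + μ₀ * (Δ Φ) 0 := by
        intro x
        have hd : Differentiable ℝ (fun y => Φ y + μ₀ * (Δ Φ) y) := hΦd.add (hΔd.const_mul μ₀)
        refine is_const_of_fderiv_eq_zero hd (fun y => ?_) x 0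
        have hy : HasFDerivAt (fun y => Φ y + μ₀ * (Δ Φ) y) (fderiv ℝ Φ y + μ₀ • fderiv ℝ (Δ Φ) y) y :=
          (hΦd y).hasFDerivAt.add ((hΔd y).hasFDerivAt.const_mul μ₀)
        rw [hy.fderiv, hμ y]
        simp
      set κ₀ : ℝ := Φ 0 + μ₀ * (Δ Φ) 0 with hκ₀
      set ψ : EuclideanSpace ℝ (Fin 3) → ℝ := fun y => Φ y - κ₀ with hψ
      have hψc : ContDiff ℝ 2 ψ := (hΦ.of_le (by norm_cast)).sub contDiff_const
      have hΔψ : ∀ x, (Δ ψ) x = (Δ Φ) x := fun x => by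
        rw [hψ, show (fun y => Φ y - κ₀) = Φ - fun _ => κ₀ from rfl]
        have hΦ2 : ContDiff ℝ 2 Φ := hΦ.of_le (by norm_cast)
        rw [hΦ2.contDiffAt.laplacian_sub (contDiff_const (c := κ₀)).contDiffAt]
        simp
      have hψval : ∀ x, ψ x = -μ₀ * (Δ Φ) x := fun x => by
        rw [hψ]; have h := hconst x; simp only; linarith
      have hψle : ∀ x, ψ x ≤ 0 := fun x => by
        rw [hψval x]; nlinarith [hsign x]
      have heq : ∀ x, (Δ ψ) x = -(1 / μ₀) * ψ x := fun x => by
        have hμ0 : μ₀ ≠ 0 := hpos.ne'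
        have e : -(1 / μ₀) * (-μ₀ * (Δ Φ) x) = (Δ Φ) x := by field_simp
        rw [hΔψ x, hψval x, e]
      have hzero := hL3 ψ (1 / μ₀) hψc (by positivity) hψle heq
      have : (Δ Φ) x₁ = 0 := by
        have h := hψval x₁
        rw [hzero x₁] at h
        have : μ₀ * (Δ Φ) x₁ = 0 := by linarith
        exact (mul_eq_zero.1 this).resolve_left hpos.ne'
      exact hx₁ this

end Summit.NavierStokesRegularity.NavierStokesRegularity.Theorems.PoloidalWindowDoorLrcModEntireTwistingTHBadDataNoGo
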